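import Summits.QuantumAdvantage.QuantumAdvantage.Theorems.ShadowDialB

/-! # ShadowDialC — part 3/4 of the landing twins of NODE «ShadowDial» (decomp-qadv lens-2 g24; node file
`g24/ShadowDial.lean`, sha256 c1ef15d9c22c1bbf…; generator `g24/tree/gen_twins.py`: namespace `Theses.ShadowDial` →
`Theorems.ShadowDial`, cut at section boundaries, docstrings added where missing, docstring-only import `AffBells22FrameJunta` dropped,
nothing else).
Content: §5 (part 1) the MULTIPLEXER family `muxStrat` (address `log₂ N − 3` cells, `2^(log₂ N − 3) > N/16` data cells): cells and
encodings, the polynomials `selF` / `muxPoly` over any field with their degree bounds, `muxStrat_mem_logpow`, DENSE-class membership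
`mux_in_dense_class`, and F-class membership `mux_shadow_mem` / `mux_stabF2`. -/

set_option linter.dupNamespace false
noncomputable section
open scoped Classical

namespace Summit.QuantumAdvantage.QuantumAdvantage.Theorems.ShadowDial
open Finset
open Literature.Computability.QuantumComplexity Literature.Computability.QuantumComplexity.RingHLF
open Literature.Computability.MetaComplexity Literature.Computability.MetaComplexity.Smolensky
open Summit.QuantumAdvantage.AdviceFreeQNC0
open Summit.QuantumAdvantage.QuantumAdvantage.Theorems.AnchorDial (outB dev loss_shape_mono)
open Summit.QuantumAdvantage.QuantumAdvantage.Theorems.HolonomyDial (tPoly tPoly_apply tPoly_mem xorP xorP_mem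
  xorP_apply_bool mono_singleton_apply indP indP_apply indP_mem)
open Summit.QuantumAdvantage.QuantumAdvantage.Theorems.StabilizerDial (apIdx apStrat apStrat_mem apStrat_apply pad
  pad_mem rel_pad_iff winset_pad StabFew outB_pad_zero)
open Summit.QuantumAdvantage.QuantumAdvantage.Theorems.SparsityDial (real_loss_of_frac stabFew_mono_mr one_le_logpow)
open Summit.QuantumAdvantage.QuantumAdvantage.Theorems.ResponseDial (mem_dev_apStrat dev_pad_zero
  not_polylogSparse_of_agree)
open Summit.QuantumAdvantage.QuantumAdvantage.Theorems.CounterDial (CounterForm StabCounter)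
open Summit.QuantumAdvantage.QuantumAdvantage.Theorems.AbelianDial (alin TableForm StabTable AbelianLoss3
  NonAbelianLoss3 tableForm_of_counterForm nT pcell qcell pcell_val qcell_val pcell_injective qcell_injective
  pcell_ne_qcell qG qG_apply qG_indB qStrat qStrat_agree qStrat_mem6 q_in_dense_class mem_dev_q_second indB
  oddZeros_indB alin_indB q_not_tableForm_zero q_not_counterForm_zero)
open Summit.QuantumAdvantage.QuantumAdvantage.Theorems.ScaleDial (logpow_add_logpow_le)

variable {N : ℕ}

section Mux

/-! ## §5 The MULTIPLEXER family `muxStrat`: inside BOTH classes — `𝔽₂`-low (F-class) AND dense / no counter /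
no bounded table (G's hypotheses) — and NOT a polylog-junta

Address cells `1 … L` (`L = log₂ N − 3`), data cells `N/2 … N/2 + 2^L − 1` (`2^L ≤ N/8`).  On the first half-cycle the
family is g19's `apStrat` (so it is DENSE, `ResponseDial.not_polylogSparse_of_agree`); at every other position `k` the
deviation gate is the MULTIPLEXER `MUX_k(x) = x_{d(k, addr x)}` — the data cell addressed (cyclically shifted by `k`) by the
`L` address bits.  `MUX_k = Σ_τ [addr = τ]·x_{d(k,τ)}` has degree `L + 1 ≤ log₂ N` over EVERY field: the family satisfies
G's degree hypothesis AND its shadow is `𝔽₂`-low at the zero gauge (`mux_stabF2`).  Yet `2^L > (m+1)^r` address patterns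
force two patterns with the same table row and different outputs: NOT `(m,r)`-table-form, hence NOT counter-form
(`mux_not_tableForm_zero`, `mux_not_counterForm_zero`); and every one of the `2^L > N/16` data cells is pivotal
(`mux_pivotal`): not a polylog-junta (the tree's junta law `AffBells22.juntaHard` has CONSTANT support).  So the F-piece
cuts INTO G's hypothesis class, beyond juntas. -/

variable (N)

/-- number of address bits `L = log₂ N − 3`. -/
def aL : ℕ := Nat.log 2 N - 3

/-- number of data cells `W = 2^L`. -/
def aW : ℕ := 2 ^ aL N

variable {N}

/-- the data width `aW N = 2^(log₂ N − 3)` is positive. -/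
theorem aW_pos : 0 < aW N := by unfold aW; positivity

/-- `2t ≤ 2^t` for every `t`. -/
theorem two_mul_le_two_pow : ∀ t : ℕ, 2 * t ≤ 2 ^ t
  | 0 => by norm_num
  | 1 => by norm_num
  | t + 2 => by have := two_mul_le_two_pow (t + 1); rw [pow_succ]; omega

/-- `8 · aW N = 2^(log₂ N)` once `log₂ N ≥ 3`. -/
theorem aW_mul_eight (hL : 3 ≤ Nat.log 2 N) : aW N * 8 = 2 ^ Nat.log 2 N := by
  unfold aW aL; rw [show (8 : ℕ) = 2 ^ 3 by norm_num, ← pow_add, Nat.sub_add_cancel hL]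

/-- a data position `N/2 + (x mod aW N)` is a cell index `< N`. -/
theorem data_lt (k : Fin N) (x : ℕ) : N / 2 + x % aW N < N := by
  have hN : 0 < N := k.pos
  have hlt := Nat.mod_lt x (aW_pos (N := N))
  by_cases hL : 3 ≤ Nat.log 2 N
  · have h := Nat.pow_log_le_self 2 (show N ≠ 0 by omega)
    have e := aW_mul_eight hL
    omega
  · have e : aW N = 1 := by unfold aW aL; rw [show Nat.log 2 N - 3 = 0 by omega, pow_zero]
    omega

/-- an address position `j + 1` (`j < aL N`) is a cell index `< N` (indeed `< N/2`). -/
theorem aL_lt (j : Fin (aL N)) : j.val + 1 < N := by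
  have hj := j.isLt
  unfold aL at hj
  have := Nat.log_le_self 2 N
  omega

/-- for `N ≥ 16`: `L + 3 = log₂ N ≤ N/2`. -/
theorem aL_add_three_le (hN : 16 ≤ N) : aL N + 3 ≤ N / 2 := by
  have hL : 4 ≤ Nat.log 2 N := Nat.le_log_of_pow_le (by norm_num) (by omega)
  have h := Nat.pow_log_le_self 2 (show N ≠ 0 by omega)
  have h2 := two_mul_le_two_pow (Nat.log 2 N)
  unfold aL; omega

/-- address cell `j ↦ cell j+1`. -/
def acell (j : Fin (aL N)) : Fin N := ⟨j.val + 1, aL_lt j⟩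

/-- encoding of address patterns by `Fin W`. -/
def enc : (Fin (aL N) → Bool) ≃ Fin (aW N) :=
  Fintype.equivFinOfCardEq (by rw [Fintype.card_fun, Fintype.card_bool, Fintype.card_fin]; rfl)

/-- data cell of pattern `τ` at position `k`: cell `N/2 + ((enc τ + k) mod W)`. -/
def dcell (k : Fin N) (τ : Fin (aL N) → Bool) : Fin N := ⟨N / 2 + ((enc τ).val + k.val) % aW N, data_lt k _⟩

/-- the `j`-th address cell is cell `j + 1`. -/
theorem acell_val (j : Fin (aL N)) : (acell j).val = j.val + 1 := rfl

/-- the data cell addressed by `τ` at output position `k` is cell `N/2 + ((enc τ + k) mod aW N)`. -/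
theorem dcell_val (k : Fin N) (τ : Fin (aL N) → Bool) : (dcell k τ).val = N / 2 + ((enc τ).val + k.val) % aW N := rfl

/-- distinct address positions have distinct address cells. -/
theorem acell_injective : Function.Injective (acell (N := N)) := by
  intro j j' h
  have := congrArg Fin.val h
  rw [acell_val, acell_val] at this
  exact Fin.ext (by omega)

/-- at a fixed output position, distinct addresses point to distinct data cells. -/
theorem dcell_injective (k : Fin N) : Function.Injective (dcell k) := by
  intro τ τ' h
  have h1 := congrArg Fin.val h
  rw [dcell_val, dcell_val] at h1
  have h2 : ((enc τ).val + k.val) % aW N = ((enc τ').val + k.val) % aW N := by omega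
  have h3 : (enc τ).val = (enc τ').val :=
    Nat.ModEq.eq_of_lt_of_lt (Nat.ModEq.add_right_cancel' k.val h2) (enc τ).isLt (enc τ').isLt
  exact enc.injective (Fin.ext h3)

/-- an address cell is never a data cell (`N ≥ 16`). -/
theorem acell_ne_dcell (hN : 16 ≤ N) (j : Fin (aL N)) (k : Fin N) (τ : Fin (aL N) → Bool) : acell j ≠ dcell k τ := by
  intro h
  have h1 := congrArg Fin.val h
  rw [acell_val, dcell_val] at h1
  have := aL_add_three_le hN
  have := j.isLt
  omega

/-- a data cell is never cell `0` (`N ≥ 16`). -/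
theorem dcell_ne_zero (hN : 16 ≤ N) (k : Fin N) (τ : Fin (aL N) → Bool) : (dcell k τ).val ≠ 0 := by
  rw [dcell_val]; omega

/-- a data cell is never the last cell `N − 1` (`N ≥ 16`). -/
theorem dcell_lt_last (hN : 16 ≤ N) (k : Fin N) (τ : Fin (aL N) → Bool) : (dcell k τ).val < N - 1 := by
  rw [dcell_val]
  have hlt := Nat.mod_lt ((enc τ).val + k.val) (aW_pos (N := N))
  have hL : 3 ≤ Nat.log 2 N := Nat.le_log_of_pow_le (by norm_num) (by omega)
  have h := Nat.pow_log_le_self 2 (show N ≠ 0 by omega)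
  have e := aW_mul_eight hL
  omega

/-! ### the multiplexer polynomial over an arbitrary field -/

section Poly

variable (F : Type*) [Field F]

/-- the bit `x_i` as a polynomial function. -/
def bF (i : Fin N) : CubeFn F N := fun x => if x i then 1 else 0

/-- the address selector `[addr x = τ] = Π_j (x_{a_j} if τ_j else 1 − x_{a_j})`, degree `L`. -/
def selF (τ : Fin (aL N) → Bool) : CubeFn F N :=
  ∏ j : Fin (aL N), (if τ j then bF F (acell j) else 1 - bF F (acell j))

/-- the multiplexer `MUX_k = Σ_τ [addr = τ] · x_{d(k,τ)}`, degree `L + 1`. -/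
def muxPoly (k : Fin N) : CubeFn F N := ∑ τ : Fin (aL N) → Bool, selF F τ * bF F (dcell k τ)

variable {F}

/-- the address selector `selF F τ` is the `0/1`-indicator of «the address cells read `τ`». -/
theorem selF_apply (τ : Fin (aL N) → Bool) (x : Fin N → Bool) :
    selF F τ x = if (∀ j, x (acell j) = τ j) then 1 else 0 := by
  unfold selF
  rw [Finset.prod_apply]
  have e : ∀ j : Fin (aL N), (if τ j then bF F (acell j) else 1 - bF F (acell j)) x =
      if x (acell j) = τ j then 1 else 0 := by
    intro j
    simp only [ite_apply, Pi.sub_apply, Pi.one_apply, bF]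
    cases τ j <;> cases x (acell j) <;> simp
  simp only [e]
  rw [Finset.prod_boole]
  simp

/-- the multiplexer polynomial evaluates to the `0/1`-indicator of the ADDRESSED data bit. -/
theorem muxPoly_apply (k : Fin N) (x : Fin N → Bool) :
    muxPoly F k x = if x (dcell k (fun j => x (acell j))) then 1 else 0 := by
  unfold muxPoly
  rw [Finset.sum_apply, Finset.sum_eq_single_of_mem (fun j => x (acell j)) (mem_univ _)]
  · rw [Pi.mul_apply, selF_apply, if_pos (fun j => rfl), one_mul]; rfl
  · intro τ _ hτ
    rw [Pi.mul_apply, selF_apply, if_neg (fun h => hτ (funext fun j => (h j).symm)), zero_mul]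

/-- the address selector has degree `≤ aL N` (a product of `aL N` literals). -/
theorem selF_mem (τ : Fin (aL N) → Bool) : selF F τ ∈ lowDeg F N (aL N) := by
  unfold selF
  have h : ∀ j ∈ (univ : Finset (Fin (aL N))),
      (if τ j then bF F (acell j) else 1 - bF F (acell j)) ∈ lowDeg F N 1 := by
    intro j _
    split
    · exact bitFn_mem_lowDeg _ le_rfl
    · exact Submodule.sub_mem _ (one_mem_lowDeg 1) (bitFn_mem_lowDeg _ le_rfl)
  have := prod_mem_lowDeg univ h
  rwa [card_univ, Fintype.card_fin, mul_one] at this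

/-- the multiplexer polynomial has degree `≤ aL N + 1`. -/
theorem muxPoly_mem (k : Fin N) : muxPoly F k ∈ lowDeg F N (aL N + 1) := by
  unfold muxPoly
  exact Submodule.sum_mem _ fun τ _ => mul_mem_lowDeg_add (selF_mem τ) (bitFn_mem_lowDeg _ le_rfl)

end Poly

/-! ### the strategy -/

/-- **the MULTIPLEXER family**: g19's `apStrat` on the first half-cycle; elsewhere `t_k ⊕ MUX_k`. -/
def muxStrat (k : Fin N) : CubeFn (ZMod 3) N :=
  if 1 ≤ k.val ∧ k.val < N / 2 then apStrat k else xorP (tPoly k) (muxPoly (ZMod 3) k)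

/-- on the first half-cycle `muxStrat` IS the antipodal pointer `apStrat` (certified density). -/
theorem muxStrat_agree (k : Fin N) (h1 : 1 ≤ k.val) (h2 : k.val < N / 2) : muxStrat k = apStrat k := by
  unfold muxStrat; rw [if_pos ⟨h1, h2⟩]

/-- `𝔽₃`-degree `≤ L + 3 = log₂ N`. -/
theorem muxStrat_mem (k : Fin N) : muxStrat k ∈ lowDeg (ZMod 3) N (aL N + 3) := by
  unfold muxStrat
  split
  · exact lowDeg_mono (by omega) (apStrat_mem k)
  · exact lowDeg_mono (by omega) (xorP_mem (tPoly_mem k) (muxPoly_mem (F := ZMod 3) k))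

/-- inside G's degree hypothesis `deg ≤ (log₂ n)^c` for every `c ≥ 1` (once `n ≥ 16`). -/
theorem muxStrat_mem_logpow (hN : 16 ≤ N) (c : ℕ) (hc : 1 ≤ c) (k : Fin N) :
    muxStrat k ∈ lowDeg (ZMod 3) N ((Nat.log 2 N) ^ c) := by
  refine lowDeg_mono ?_ (muxStrat_mem k)
  have hL : 4 ≤ Nat.log 2 N := Nat.le_log_of_pow_le (by norm_num) (by omega)
  have : aL N + 3 = Nat.log 2 N := by unfold aL; omega
  rw [this]; exact Nat.le_self_pow (by omega) _

/-- DENSE (not polylog-stabilizer-sparse), inside the degree hypothesis. -/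
theorem mux_in_dense_class (a c : ℕ) (hc : 1 ≤ c) :
    ∃ n₀ : ℕ, ∀ n ≥ n₀, (∀ i : Fin n, muxStrat i ∈ lowDeg (ZMod 3) n ((Nat.log 2 n) ^ c)) ∧
      ¬ StabFew ((Nat.log 2 n) ^ a) 0 (c + 1) (fun j : Fin n => muxStrat j) := by
  obtain ⟨n₀, hn₀⟩ := not_polylogSparse_of_agree (fun n (j : Fin n) => muxStrat j)
    (fun n j h1 h2 => muxStrat_agree j h1 h2) a (c + 1)
  exact ⟨max n₀ 16, fun n hn => ⟨fun i => muxStrat_mem_logpow (le_trans (le_max_right _ _) hn) c hc i,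
    hn₀ n (le_trans (le_max_left _ _) hn)⟩⟩

/-- off the first half-cycle `muxStrat k` outputs the `0/1`-indicator of `tGuess ⊕ (addressed data bit)`. -/
theorem muxStrat_apply_second (y : Fin N → Bool) (k : Fin N) (hk : ¬ (1 ≤ k.val ∧ k.val < N / 2)) :
    muxStrat k y = if xor (tGuess y k) (y (dcell k (fun j => y (acell j)))) then 1 else 0 := by
  unfold muxStrat; rw [if_neg hk]
  exact xorP_apply_bool _ _ y _ _ (tPoly_apply k y) (muxPoly_apply k y)

/-- outside the first half-cycle, position `k` deviates from the canonical guess iff the ADDRESSED DATA BIT is on. -/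
theorem mem_dev_mux_second (y : Fin N → Bool) (k : Fin N) (hk : ¬ (1 ≤ k.val ∧ k.val < N / 2)) :
    k ∈ dev (fun i : Fin N => muxStrat i) y ↔ y (dcell k (fun j => y (acell j))) = true := by
  simp only [Summit.QuantumAdvantage.QuantumAdvantage.Theorems.AnchorDial.dev, mem_filter, mem_univ, true_and,
    muxStrat_apply_second y k hk]
  generalize tGuess y k = t; generalize y (dcell k fun j => y (acell j)) = q
  cases t <;> cases q <;> decide

/-! ### (i) the shadow is `𝔽₂`-LOW: the family is in the F-class -/

/-- The `𝔽₂`-indicator of a triple XOR is the sum of the three indicators. -/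
theorem xor3_indicator (a b c : Bool) :
    (if xor (xor a b) c then (1 : ZMod 2) else 0) = (if a then 1 else 0) + (if b then 1 else 0) + (if c then 1 else 0) := by
  cases a <;> cases b <;> cases c <;> decide

/-- if an output polynomial takes the `0/1` value of a Boolean `b`, its shadow is the `0/1` value of `b` in `𝔽₂`. -/
theorem shadow_of_bool (P : Fin N → CubeFn (ZMod 3) N) (k : Fin N) (x : Fin N → Bool) (b : Bool)
    (h : P k x = if b then 1 else 0) : shadow P k x = if b then 1 else 0 := by
  show (if P k x = 1 then (1 : ZMod 2) else 0) = _
  rw [h]; cases b <;> simp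

/-- every output bit of the multiplexer family is an `𝔽₂`-polynomial of degree `≤ L + 1 < log₂ N`. -/
theorem mux_shadow_mem (k : Fin N) : shadow (fun i : Fin N => muxStrat i) k ∈ lowDeg (ZMod 2) N (aL N + 1) := by
  by_cases hk : 1 ≤ k.val ∧ k.val < N / 2
  · have e : shadow (fun i : Fin N => muxStrat i) k = bF (ZMod 2) k + bF (ZMod 2) (nxt k) + bF (ZMod 2) (apIdx k) := by
      funext x
      have happ : (fun i : Fin N => muxStrat i) k x = if xor (tGuess x k) (x (apIdx k)) then 1 else 0 := by
        show muxStrat k x = _; rw [muxStrat_agree k hk.1 hk.2, apStrat_apply]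
      rw [shadow_of_bool _ k x _ happ]
      unfold tGuess
      simp only [Pi.add_apply, bF]
      exact xor3_indicator _ _ _
    rw [e]
    exact Submodule.add_mem _ (Submodule.add_mem _ (bitFn_mem_lowDeg _ (by omega)) (bitFn_mem_lowDeg _ (by omega)))
      (bitFn_mem_lowDeg _ (by omega))
  · have e : shadow (fun i : Fin N => muxStrat i) k = bF (ZMod 2) k + bF (ZMod 2) (nxt k) + muxPoly (ZMod 2) k := by
      funext x
      rw [shadow_of_bool _ k x _ (muxStrat_apply_second x k hk), Pi.add_apply, Pi.add_apply, muxPoly_apply]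
      unfold tGuess
      simp only [bF]
      exact xor3_indicator _ _ _
    rw [e]
    exact Submodule.add_mem _ (Submodule.add_mem _ (bitFn_mem_lowDeg _ (by omega)) (bitFn_mem_lowDeg _ (by omega)))
      (muxPoly_mem k)

/-- **★ the multiplexer family is CHEAPLY `𝔽₂`-LOW** (zero gauge) at every level `(e, e')` with `e' ≥ 1`: it lies in the
F-class, so its loss is decided by `shadow_holds` — although it is dense, counter-free, table-free and reads `> N/16` cells. -/
theorem mux_stabF2 (hN : 16 ≤ N) (e e' : ℕ) (he' : 1 ≤ e') : StabF2 e e' (fun k : Fin N => muxStrat k) := by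
  refine ⟨fun _ => 0, fun _ => Submodule.zero_mem _, fun k => ?_⟩
  rw [shadow_pad_zero]
  refine lowDeg_mono ?_ (mux_shadow_mem k)
  have hL : 4 ≤ Nat.log 2 N := Nat.le_log_of_pow_le (by norm_num) (by omega)
  have : aL N + 1 ≤ Nat.log 2 N := by unfold aL; omega
  exact this.trans (Nat.le_self_pow (by omega) _)

/-! ### (ii) NOT `(m,r)`-table-form, NOT counter-form (zero gauge) -/

end Mux

end Summit.QuantumAdvantage.QuantumAdvantage.Theorems.ShadowDial
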